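import Summits.Ventures.Crystal3D.Kissing125.GSearchCheck2
import HarnessLib

/-!
# Bridge: the generic checker at κ25 IS the landed K25 checker

HONEST FRAMING (cell pub-crystal3d, K-path at `h = 5/4`, V4 = κ as an explicit parameter): this is NOT a result printed
by Hales; it is his METHOD (arXiv:1209.6043, Theorem 3 + Lemmas 7–10, in the tree's form of a verified interval-arithmetic
growth search, `Literature/…/KissingSearch*.lean`) with the largest long-side cosine `κ` made an EXPLICIT PARAMETER
(`κ : Kappa`, carrying the two numeric facts the soundness proof uses: `-1/2 ≤ κ`, `κ < 1/4`).  Only the declarations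
whose statement depends on `κ` are declared here (namespace `…Kissing125.GSearch`, the tree's short names, no renames);
every κ-free helper is the landed K25 copy (`…Kissing125.KissingSearch.*`) and every κ-free lemma is cited from the tree
(PRIVATE per-file citation aliases; `GSearchTransport.lean` holds `toT : St → tree St` and the transport equalities).  The K25
instance is `κ25 = ⟨7/32, …⟩`; `GSearchBridge.lean` identifies the generic checker at
`κ25` with the landed `Kissing125.KissingSearch.checkPart`, so the landed run files are consumed unchanged.  Generated by
`HOME/lean/kissing125/v4-prep/gen/mkgen.py`; nothing here is asserted about GAP(1.26) or any census.

THIS FILE: 27 equalities `GSearch.X κ25 = Kissing125.KissingSearch.X` for the κ-chain (unfold/rw; induction for the five recursive ones), ending in `checkPart_κ25`; with it the landed `SearchRun000–255` files are consumed unchanged by the generic soundness theorem `GSearch.concl_of_parts`.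

## References
* T. C. Hales, *A proof of Fejes Tóth's conjecture on sphere packings with kissing number twelve*,
  arXiv:1209.6043 (2012): Definition 1, Theorem 2, Theorem 3, Lemmas 7–10. [`Hales2012`]
* R. E. Moore, *Interval Analysis* (1966), Theorem 3.1, §4.4. [`Moore1966`]
-/

namespace Summit.Ventures.Crystal3D.Kissing125

open Literature.Geometry.DiscreteGeometry
open Summit.Ventures.Crystal3D.Kissing125.KissingSearch

namespace GSearch

open Real Literature.Analysis.ValidatedNumerics KissingLP NonemptyInterval Finset

/-! ## Bridge: the generic chain at `κ25` equals the base's chain -/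


/-- Bridge: the generic `gridPt` at `κ25` is the base's `gridPt`. [folklore] -/
theorem gridPt_κ25 : @gridPt κ25 = @Summit.Ventures.Crystal3D.Kissing125.KissingSearch.gridPt := rfl
/-- Bridge: the generic `symIv` at `κ25` is the base's `symIv`. [folklore] -/
theorem symIv_κ25 : @symIv κ25 = @Summit.Ventures.Crystal3D.Kissing125.KissingSearch.symIv := rfl
/-- Bridge: the generic `symBox` at `κ25` is the base's `symBox`. [folklore] -/
theorem symBox_κ25 : @symBox κ25 = @Summit.Ventures.Crystal3D.Kissing125.KissingSearch.symBox := rfl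
/-- Bridge: the generic `basic` at `κ25` is the base's `basic`. [folklore] -/
theorem basic_κ25 : @basic κ25 = @Summit.Ventures.Crystal3D.Kissing125.KissingSearch.basic := by
  unfold basic Summit.Ventures.Crystal3D.Kissing125.KissingSearch.basic; rw [symBox_κ25]; try rfl

/-- Bridge: the generic `BTAB` at `κ25` is the base's `BTAB`. [folklore] -/
theorem BTAB_κ25 : @BTAB κ25 = @Summit.Ventures.Crystal3D.Kissing125.KissingSearch.BTAB := by
  unfold BTAB Summit.Ventures.Crystal3D.Kissing125.KissingSearch.BTAB; rw [basic_κ25]; try rfl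

/-- Bridge: the generic `btab` at `κ25` is the base's `btab`. [folklore] -/
theorem btab_κ25 : @btab κ25 = @Summit.Ventures.Crystal3D.Kissing125.KissingSearch.btab := by
  unfold btab Summit.Ventures.Crystal3D.Kissing125.KissingSearch.btab; rw [BTAB_κ25]; try rfl

/-- Bridge: the generic `rangeC` at `κ25` is the base's `rangeC`. [folklore] -/
theorem rangeC_κ25 : @rangeC κ25 = @Summit.Ventures.Crystal3D.Kissing125.KissingSearch.rangeC := by
  unfold rangeC Summit.Ventures.Crystal3D.Kissing125.KissingSearch.rangeC; rw [btab_κ25]; try rfl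

/-- Bridge: the generic `T1TAB` at `κ25` is the base's `T1TAB`. [folklore] -/
theorem T1TAB_κ25 : @T1TAB κ25 = @Summit.Ventures.Crystal3D.Kissing125.KissingSearch.T1TAB := by
  unfold T1TAB Summit.Ventures.Crystal3D.Kissing125.KissingSearch.T1TAB; rw [rangeC_κ25]; try rfl

/-- Bridge: the generic `t1` at `κ25` is the base's `t1`. [folklore] -/
theorem t1_κ25 : @t1 κ25 = @Summit.Ventures.Crystal3D.Kissing125.KissingSearch.t1 := by
  unfold t1 Summit.Ventures.Crystal3D.Kissing125.KissingSearch.t1; rw [T1TAB_κ25]; try rfl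

/-- Bridge: the generic `rangeBr` at `κ25` is the base's `rangeBr`. [folklore] -/
theorem rangeBr_κ25 : @rangeBr κ25 = @Summit.Ventures.Crystal3D.Kissing125.KissingSearch.rangeBr := by
  unfold rangeBr Summit.Ventures.Crystal3D.Kissing125.KissingSearch.rangeBr; rw [t1_κ25]; try rfl

/-- Bridge: the generic `THMIN` at `κ25` is the base's `THMIN`. [folklore] -/
theorem THMIN_κ25 : @THMIN κ25 = @Summit.Ventures.Crystal3D.Kissing125.KissingSearch.THMIN := by
  unfold THMIN Summit.Ventures.Crystal3D.Kissing125.KissingSearch.THMIN; rw [BTAB_κ25]; try rfl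

/-- Bridge: the generic `St.slotBr` at `κ25` is the base's `St.slotBr`. [folklore] -/
theorem slotBr_κ25 : @St.slotBr κ25 = @Summit.Ventures.Crystal3D.Kissing125.KissingSearch.St.slotBr := by
  unfold St.slotBr Summit.Ventures.Crystal3D.Kissing125.KissingSearch.St.slotBr; rw [rangeBr_κ25]; try rfl

/-- Bridge: the generic `St.trimSide` at `κ25` is the base's `St.trimSide`. [folklore] -/
theorem trimSide_κ25 : @St.trimSide κ25 = @Summit.Ventures.Crystal3D.Kissing125.KissingSearch.St.trimSide := by
  unfold St.trimSide Summit.Ventures.Crystal3D.Kissing125.KissingSearch.St.trimSide; rw [rangeBr_κ25]; try rfl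

/-- Bridge: the generic `St.slotSums` at `κ25` is the base's `St.slotSums`. [folklore] -/
theorem slotSums_κ25 : @St.slotSums κ25 = @Summit.Ventures.Crystal3D.Kissing125.KissingSearch.St.slotSums := by
  unfold St.slotSums Summit.Ventures.Crystal3D.Kissing125.KissingSearch.St.slotSums; rw [slotBr_κ25]; try rfl

/-- Bridge: the generic `St.trimAt` at `κ25` is the base's `St.trimAt`. [folklore] -/
theorem trimAt_κ25 : @St.trimAt κ25 = @Summit.Ventures.Crystal3D.Kissing125.KissingSearch.St.trimAt := by
  unfold St.trimAt Summit.Ventures.Crystal3D.Kissing125.KissingSearch.St.trimAt; rw [slotBr_κ25, trimSide_κ25]; try rfl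

/-- Bridge: the generic `St.nodeRule` at `κ25` is the base's `St.nodeRule`. [folklore] -/
theorem nodeRule_κ25 : @St.nodeRule κ25 = @Summit.Ventures.Crystal3D.Kissing125.KissingSearch.St.nodeRule := by
  unfold St.nodeRule Summit.Ventures.Crystal3D.Kissing125.KissingSearch.St.nodeRule; rw [slotSums_κ25, trimAt_κ25, THMIN_κ25]; try rfl

/-- Bridge: the generic `St.trimTrisAt` at `κ25` is the base's `St.trimTrisAt`. [folklore] -/
theorem trimTrisAt_κ25 : @St.trimTrisAt κ25 = @Summit.Ventures.Crystal3D.Kissing125.KissingSearch.St.trimTrisAt := by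
  unfold St.trimTrisAt Summit.Ventures.Crystal3D.Kissing125.KissingSearch.St.trimTrisAt; rw [trimSide_κ25]; try rfl

/-- Bridge: the generic `St.localStep` at `κ25` is the base's `St.localStep`. [folklore] -/
theorem localStep_κ25 : @St.localStep κ25 = @Summit.Ventures.Crystal3D.Kissing125.KissingSearch.St.localStep := by
  unfold St.localStep Summit.Ventures.Crystal3D.Kissing125.KissingSearch.St.localStep; rw [trimTrisAt_κ25, nodeRule_κ25]; try rfl

/-- Bridge: the generic `St.propagateWL`/`propagateWL` at `κ25` is the base's (by induction on the fuel / list). [folklore] -/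
theorem propagateWL_κ25 : @St.propagateWL κ25 = @Summit.Ventures.Crystal3D.Kissing125.KissingSearch.St.propagateWL := by
  funext s n l
  induction n generalizing s l with
  | zero => rfl
  | succ n ih =>
    cases l with
    | nil => rfl
    | cons v rest => simp only [St.propagateWL, Summit.Ventures.Crystal3D.Kissing125.KissingSearch.St.propagateWL, localStep_κ25, ih]; try rfl

/-- Bridge: the generic `St.propagate` at `κ25` is the base's `St.propagate`. [folklore] -/
theorem propagate_κ25 : @St.propagate κ25 = @Summit.Ventures.Crystal3D.Kissing125.KissingSearch.St.propagate := by
  unfold St.propagate Summit.Ventures.Crystal3D.Kissing125.KissingSearch.St.propagate; rw [propagateWL_κ25]; try rfl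

/-- Bridge: the generic `St.refute`/`refute` at `κ25` is the base's (by induction on the fuel / list). [folklore] -/
theorem refute_κ25 : @St.refute κ25 = @Summit.Ventures.Crystal3D.Kissing125.KissingSearch.St.refute := by
  funext s n
  induction n generalizing s with
  | zero => rfl
  | succ n ih => simp only [St.refute, Summit.Ventures.Crystal3D.Kissing125.KissingSearch.St.refute, propagate_κ25, ih]; try rfl

/-- Bridge: the generic `St.expand` at `κ25` is the base's `St.expand`. [folklore] -/
theorem expand_κ25 : @St.expand κ25 = @Summit.Ventures.Crystal3D.Kissing125.KissingSearch.St.expand := by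
  unfold St.expand Summit.Ventures.Crystal3D.Kissing125.KissingSearch.St.expand; rw [propagateWL_κ25, refute_κ25]; try rfl

/-- Bridge: the generic `St.search`/`search` at `κ25` is the base's (by induction on the fuel / list). [folklore] -/
theorem search_κ25 : @St.search κ25 = @Summit.Ventures.Crystal3D.Kissing125.KissingSearch.St.search := by
  funext s d n
  induction n generalizing s d with
  | zero => rfl
  | succ n ih => simp only [St.search, Summit.Ventures.Crystal3D.Kissing125.KissingSearch.St.search, expand_κ25, ih]; try rfl

/-- Bridge: the generic `stepAll` at `κ25` is the base's (by induction on the fuel / list). [folklore] -/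
theorem stepAll_κ25 : @stepAll κ25 = @Summit.Ventures.Crystal3D.Kissing125.KissingSearch.stepAll := by
  funext L
  induction L with
  | nil => rfl
  | cons p rest ih => simp only [stepAll, Summit.Ventures.Crystal3D.Kissing125.KissingSearch.stepAll, expand_κ25, ih]; try rfl

/-- Bridge: the generic `frontier` at `κ25` is the base's (by induction on the fuel / list). [folklore] -/
theorem frontier_κ25 : @frontier κ25 = @Summit.Ventures.Crystal3D.Kissing125.KissingSearch.frontier := by
  funext L j
  induction j generalizing L with
  | zero => rfl
  | succ j ih => simp only [frontier, Summit.Ventures.Crystal3D.Kissing125.KissingSearch.frontier, stepAll_κ25, ih]; try rfl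

/-- Bridge: the generic `checkPart` at `κ25` is the base's `checkPart`. [folklore] -/
theorem checkPart_κ25 : @checkPart κ25 = @Summit.Ventures.Crystal3D.Kissing125.KissingSearch.checkPart := by
  unfold checkPart Summit.Ventures.Crystal3D.Kissing125.KissingSearch.checkPart; rw [frontier_κ25, search_κ25]; try rfl

/-- Bridge: the generic `checkAll` at `κ25` is the base's `checkAll`. [folklore] -/
theorem checkAll_κ25 : @checkAll κ25 = @Summit.Ventures.Crystal3D.Kissing125.KissingSearch.checkAll := by
  unfold checkAll Summit.Ventures.Crystal3D.Kissing125.KissingSearch.checkAll; rw [search_κ25]; try rfl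

end GSearch

end Summit.Ventures.Crystal3D.Kissing125
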